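import Mathlib
import HarnessLib
import HarnessLib.Audit
import Summits.ValiantsHypothesis.ValiantsHypothesis.Theorems.LacunarySymmetroidMatrixDescartesWellLemma

/-!
# ValiantsHypothesis / LacunarySymmetroid — crux `MatrixDescartes` (stmt-ValiantsHypothesis-18050, V1), LINE (A) «product_plus_one»:
# the exact DICTIONARY of the A-function (pen val-idea-25 NOTE §54.12 / §54.15(a); objects = pen g9 Sketch `Sketch-ALaw-s57.lean` texts)

The A-function of LINE (A) (NOTE §54.15a/§55.0, pen g9 Sketch `abprobe/s57/card/Sketch-ALaw-s57.lean` e7e1dd8c1c321afb):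
`A(x) = Σ_f λ_f h_f(x − u_f)`, row kernel `h(v) = (1−ξ)(e^v − τ)(1 + e^v)/(D₁(v) D₃(v))`, `τ = ξ/(1−ξ)`,
`D_k(v) = (1+e^v)² + 2c_k η e^{ξv}(1+e^v) + η² e^{2ξv}`, `c_k = ±cos kπξ` (KC `+`, W `−`).  The definitions `csign`, `Dfac`,
`rowKernel`, `Afun` below are the Sketch's texts VERBATIM (the Sketch lives in the crux evidence store, not importable).  PROVED here
(exact identities, NOTE §54.12 «WHERE ξ AND η ENTER»): with the bump `ρ = η e^{ξv}/(1 + e^v)`,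
* `Dfac_eq`      : `D_k(v) = (1 + e^v)² · (1 + 2c_kρ + ρ²)`;
* `Dfac_mul_Dfac`: `D₁ D₃ = (1 + e^v)⁴ · Rquart c₁ c₃ ρ` (the modulator quartic of `…WellLemma`);
* `rowKernel_eq` : `h(v) = (1−ξ) · κ(v) · M(v)`, `κ(v) = (e^v − τ)/(1 + e^v)³` (ONE fixed kernel), `M = 1/Rquart c₁ c₃ ρ` (the modulator);
* `csign_three`  : every row lies on the Chebyshev curve `c₃ = 4c₁³ − 3c₁` (so `…WellLemma.noWellLemma`/`wellLemmaB` apply);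
* `Dfac_pos`, `rowKernel_den_ne_zero`: off the pole values the denominators are positive;
* `Afun_eq`      : `A(x) = (1−ξ) Σ_f λ_f κ(x − u_f) M_f(x)` — the form in which the TOY (`M ≡ 1`, `…ToyALawMain.toyALaw`) and the
  WELL LEMMA (shape of `M`) are stated.
Nothing here is a law: the A-LAW / T1† / T′ are located statements of the NOTE and stay untyped as theorems (card r1 price P3).

HONEST FRAMING: exact identities about LINE (A)'s A-function; no stub of LINE (A) is touched (A40 unchanged, sorries 4 → 4);
`MatrixDescartes` OPEN; `VP ≠ VNP` is NOT proved and nothing here bears on it.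
-/

set_option linter.dupNamespace false

namespace Summit.ValiantsHypothesis.ValiantsHypothesis.Theorems.LacunarySymmetroidMatrixDescartes

namespace ADictionary

open Real Finset WellLemma

noncomputable section

/-- The sign `c_k` of a row: `−cos(kπξ)` (W) or `+cos(kπξ)` (KC).  (pen g9 Sketch text) -/
def csign (kc : Bool) (k : ℕ) (ξ : ℝ) : ℝ :=
  (if kc then 1 else -1) * Real.cos (k * Real.pi * ξ)

/-- One quadratic factor of the row denominator, `(1+e^v)² + 2 c η e^{ξ v}(1+e^v) + η² e^{2ξ v}`.  (pen g9 Sketch text) -/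
def Dfac (ξ η c v : ℝ) : ℝ :=
  (1 + Real.exp v) ^ 2 + 2 * c * η * Real.exp (ξ * v) * (1 + Real.exp v) + η ^ 2 * Real.exp (2 * ξ * v)

/-- The row kernel `h(v) = (1−ξ)(e^v − τ)(1+e^v)/(D₁ D₃)`, `τ = ξ/(1−ξ)`.  (pen g9 Sketch text) -/
def rowKernel (ξ : ℝ) (kc : Bool) (η v : ℝ) : ℝ :=
  (1 - ξ) * (Real.exp v - ξ / (1 - ξ)) * (1 + Real.exp v) /
    (Dfac ξ η (csign kc 1 ξ) v * Dfac ξ η (csign kc 3 ξ) v)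

/-- The company function `A(x) = Σ_f λ_f h_{f}(x − u_f)` (ACTUAL values, NOTE §54.15a).  (pen g9 Sketch text) -/
def Afun (ξ : ℝ) (r : ℕ) (kc : Fin r → Bool) (u η lam : Fin r → ℝ) (x : ℝ) : ℝ :=
  ∑ f, lam f * rowKernel ξ (kc f) (η f) (x - u f)

/-- The bump `ρ(v) = η e^{ξv}/(1 + e^v)` of NOTE §54.10/§54.12. -/
def bump (ξ η v : ℝ) : ℝ := η * Real.exp (ξ * v) / (1 + Real.exp v)

/-- The fixed kernel `κ(v) = (e^v − τ)/(1 + e^v)³`, `τ = ξ/(1−ξ)` (NOTE §54.12). -/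
def kappa (ξ v : ℝ) : ℝ := (Real.exp v - ξ / (1 - ξ)) / (1 + Real.exp v) ^ 3

/-! ## The identities -/

/-- `1 + e^v > 0`. -/
theorem one_add_exp_pos (v : ℝ) : 0 < 1 + Real.exp v := by positivity

/-- **NOTE §54.12**: `D_k(v) = (1 + e^v)²·(1 + 2c_kρ + ρ²)`, `ρ = η e^{ξv}/(1+e^v)`. -/
theorem Dfac_eq (ξ η c v : ℝ) :
    Dfac ξ η c v = (1 + Real.exp v) ^ 2 * (1 + 2 * c * bump ξ η v + bump ξ η v ^ 2) := by
  have hy : (1 + Real.exp v) ≠ 0 := (one_add_exp_pos v).ne'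
  have h2 : Real.exp (2 * ξ * v) = Real.exp (ξ * v) ^ 2 := by
    rw [← Real.exp_nat_mul]; ring_nf
  rw [Dfac, bump, h2]
  field_simp

/-- The bump is positive for `η > 0`. -/
theorem bump_pos {ξ η : ℝ} (hη : 0 < η) (v : ℝ) : 0 < bump ξ η v := by
  unfold bump; positivity

/-- **NOTE §54.12**: `D₁(v)·D₃(v) = (1 + e^v)⁴ · R(ρ)` with the modulator quartic `R = Rquart c₁ c₃` of `…WellLemma`. -/
theorem Dfac_mul_Dfac (ξ η c₁ c₃ v : ℝ) :
    Dfac ξ η c₁ v * Dfac ξ η c₃ v = (1 + Real.exp v) ^ 4 * Rquart c₁ c₃ (bump ξ η v) := by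
  rw [Dfac_eq, Dfac_eq, Rquart]; ring

/-- **NOTE §54.12 (the κ·M dictionary)**: `h(v) = (1−ξ) · κ(v) · (Rquart c₁ c₃ ρ)⁻¹` with ONE fixed kernel `κ(v) = (e^v − τ)/(1+e^v)³`
and the MODULATOR `M = 1/R(ρ)` (`c_k = csign kc k ξ`).  (Lean's total division makes this an identity with no side condition.) -/
theorem rowKernel_eq (ξ : ℝ) (kc : Bool) (η v : ℝ) :
    rowKernel ξ kc η v = (1 - ξ) * kappa ξ v * (Rquart (csign kc 1 ξ) (csign kc 3 ξ) (bump ξ η v))⁻¹ := by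
  have hy : (1 + Real.exp v) ≠ 0 := (one_add_exp_pos v).ne'
  rw [rowKernel, Dfac_mul_Dfac, kappa]
  by_cases hR : Rquart (csign kc 1 ξ) (csign kc 3 ξ) (bump ξ η v) = 0
  · rw [hR]; simp
  · field_simp

/-- Every row lies on the CHEBYSHEV CURVE: `c₃ = 4c₁³ − 3c₁` for both types (`T₃` is odd). -/
theorem csign_three (kc : Bool) (ξ : ℝ) : csign kc 3 ξ = 4 * csign kc 1 ξ ^ 3 - 3 * csign kc 1 ξ := by
  cases kc
  · simp [csign]; rw [show (3 : ℝ) * Real.pi * ξ = 3 * (Real.pi * ξ) by ring, Real.cos_three_mul]; ring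
  · simp [csign]; rw [show (3 : ℝ) * Real.pi * ξ = 3 * (Real.pi * ξ) by ring, Real.cos_three_mul]

/-- `c₁ + c₃ = ±2cos(πξ)cos(2πξ)`: the sign that separates LOUD from TAME rows in `…WellLemma`. -/
theorem csign_one_add_three (kc : Bool) (ξ : ℝ) :
    csign kc 1 ξ + csign kc 3 ξ = (if kc then 1 else -1) * (2 * Real.cos (Real.pi * ξ) * Real.cos (2 * (Real.pi * ξ))) := by
  cases kc <;>
    (simp [csign]; rw [show (3 : ℝ) * Real.pi * ξ = 3 * (Real.pi * ξ) by ring, Real.cos_three_mul, Real.cos_two_mul]; ring)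

/-- `|c_k| ≤ 1`. -/
theorem abs_csign_le_one (kc : Bool) (k : ℕ) (ξ : ℝ) : |csign kc k ξ| ≤ 1 := by
  unfold csign
  cases kc <;> simp [Real.abs_cos_le_one]

/-- Off the pole value `|c| < 1` the quadratic factor is positive (`η` arbitrary). -/
theorem Dfac_pos {c : ℝ} (hc : |c| < 1) (ξ η v : ℝ) : 0 < Dfac ξ η c v := by
  rw [Dfac_eq]
  have hc' := abs_lt.1 hc
  have : 0 < 1 + 2 * c * bump ξ η v + bump ξ η v ^ 2 := by nlinarith [sq_nonneg (bump ξ η v + c)]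
  exact mul_pos (pow_pos (one_add_exp_pos v) 2) this

/-- Off the pole (`|c₁| < 1`, `|c₃| < 1`) the row kernel's denominator is nonzero. -/
theorem rowKernel_den_ne_zero {ξ : ℝ} {kc : Bool} (h1 : |csign kc 1 ξ| < 1) (h3 : |csign kc 3 ξ| < 1) (η v : ℝ) :
    Dfac ξ η (csign kc 1 ξ) v * Dfac ξ η (csign kc 3 ξ) v ≠ 0 :=
  mul_ne_zero (Dfac_pos h1 ξ η v).ne' (Dfac_pos h3 ξ η v).ne'

/-- **The company function in dictionary form**: `A(x) = (1−ξ) Σ_f λ_f κ(x − u_f) · M_f(x)`, `M_f = 1/Rquart c₁ c₃ (ρ_f)`,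
`ρ_f = η_f e^{ξ(x−u_f)}/(1 + e^{x−u_f})` (NOTE §54.12: «ξ and the η_f enter A only through τ, c₁, c₃ and the bumps»). -/
theorem Afun_eq (ξ : ℝ) (r : ℕ) (kc : Fin r → Bool) (u η lam : Fin r → ℝ) (x : ℝ) :
    Afun ξ r kc u η lam x = (1 - ξ) * ∑ f, lam f * kappa ξ (x - u f) *
      (Rquart (csign (kc f) 1 ξ) (csign (kc f) 3 ξ) (bump ξ (η f) (x - u f)))⁻¹ := by
  rw [Afun, mul_sum]
  refine sum_congr rfl fun f _ => ?_
  rw [rowKernel_eq]; ring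

/-- In the binomial limit `η_f = 0` the modulator is `1` (`ρ = 0`, `R(0) = 1`): `h(v) = (1−ξ)κ(v)` — the TOY kernel of
`…ToyALawMain` (`A_toy`, NOTE §54.13). -/
theorem rowKernel_eta_zero (ξ : ℝ) (kc : Bool) (v : ℝ) : rowKernel ξ kc 0 v = (1 - ξ) * kappa ξ v := by
  rw [rowKernel_eq, bump, Rquart]; simp

end

end ADictionary

end Summit.ValiantsHypothesis.ValiantsHypothesis.Theorems.LacunarySymmetroidMatrixDescartes
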